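import Summits.ResolutionOfSingularities.ResolutionOfSingularities.Theorems.FrobeniusClosingSteerRegularCurveGerm
import Summits.ResolutionOfSingularities.ResolutionOfSingularities.Theorems.FrobeniusClosingSteerInsepStepNotIsolated
import Summits.ResolutionOfSingularities.ResolutionOfSingularities.Theorems.FrobeniusClosingSteerNestedCohenFrames
import Summits.ResolutionOfSingularities.ResolutionOfSingularities.Theorems.FrobeniusClosingSteerRadicandNonIsolatedOfOddSupport
import Summits.ResolutionOfSingularities.ResolutionOfSingularities.Theorems.FrobeniusClosingSteerCompletionPowTransfer
import Literature.AlgebraicGeometry.Resolution.QuadraticTransforms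
import Literature.AlgebraicGeometry.Resolution.ExcellentRings
import Summits.ResolutionOfSingularities.ResolutionOfSingularities.Theorems.FrobeniusClosingSteerNonRationalStepFormalSquareCriterion
import HarnessLib

/-!
# Crux `Steer` (stmt-ResolutionOfSingularities-16345), chain W4.1 — K-I2 FILE H (part 1 of 2): **preliminaries for the I″ kernel**

OURS (campaign `res-hironaka`, rung L ★L-G4, slot W4.1; res-L0-w41-idea-3 blueprint `K-I2-BLUEPRINT.md` ae0581fa150ab9c1 / signatures
`K-I2_signatures.lean` e62c805738af0a97 §FILE H). Candidates, not facts; nothing here is a statement of H. Hironakaʼs manuscript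
[Hironaka2017] (status: under review). AI-written; AI review is weaker than expert review. Theses-free and definition-free.

CONTENT — the self-contained pieces of the proof of `LemmaI2.nonRationalStepNotIsolated_holds` (part 2,
`FrobeniusClosingSteerNonRationalStepNotIsolated.lean`), split off to keep both files short:
* `totalDegree_chartReading_le`, `eval₂_one_cons_eq_sum` — chart readings `Σ_β c_β T^{β₁} U^{β₂}` of forms and their degree;
* `card_le_finrank_of_indep` — an `𝔪`-independent family over `S₀` of `q` elements of `S₁ = B_𝔮` forces `q ≤ [κ(𝔫) : κ₀]`;
* `exists_span_triple_eq_maximalIdeal` — a regular 1-dimensional quotient `S ⧸ (a, b)` gives a regular system `(a, b, t)`;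
* `exists_chart_fin_two` — the chart map `Θ : S₀[𝔪₀/X] → κ₀[T, U]` (`ClaimR.exists_chartMap` re-indexed by `Fin 2`);
* `exists_mul_eq_of_span_singleton_eq`, `not_mem_span_singleton_of_ringKrullDim` — `x₀S₁ = XS₁` bookkeeping and `Θ(w_B) ≠ 0`;
* `exists_clean_reading` — the cleaning `f₁ − g₁² ∈ 𝔪₁^d` read in the chart ring: `s²F_b = b² + b′`, `s ∉ 𝔮`, `b′ ∈ 𝔮^d`;
* `not_hasIsolatedSingularity_of_forall_derivation` — the closing move: if every `ℤ`-derivation of `K′⟦X₀,X₁,X₂⟧ ≃ Ŝ₁` takes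
  (a unit-square multiple of) `f̂₁` into `(X₀, X₁) = (x̂₀, ŵ)`, then the formal square criterion (FILE C), the persistent-arc
  criterion and excellent descent give `¬ HasIsolatedSingularity (RadicandRing S₁ 2 f₁)`.
[cite: Matsumura1987, Thm. 14.2, Thm. 28.3, Thm. 30.6] [cite: Cutkosky2014, §2.1] [folklore]
-/

noncomputable section

set_option linter.dupNamespace false

open IsLocalRing Module MvPolynomial

namespace Summit.ResolutionOfSingularities.ResolutionOfSingularities.Theorems.SwitchingDichotomy.LemmaI2

open Literature.AlgebraicGeometry.Resolution
open Summit.ResolutionOfSingularities.ResolutionOfSingularities.Theorems.SwitchingDichotomy.Words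

/-! ## Degrees, residue degrees, regular systems -/

/-- Degree of a chart reading: `Σ_β C(ρ c_β)·T^{β₁}·U^{β₂}` over the support of a form of degree `n` has total degree `≤ n`. [folklore] -/
theorem totalDegree_chartReading_le {R K : Type*} [CommRing R] [Field K] (ρ : R →+* K) {Φ : MvPolynomial (Fin 3) R} {n : ℕ}
    (hΦ : Φ.IsHomogeneous n) :
    (∑ β ∈ Φ.support, C (ρ (coeff β Φ)) * X 0 ^ (β 1) * X 1 ^ (β 2) : MvPolynomial (Fin 2) K).totalDegree ≤ n := by
  refine totalDegree_finsetSum_le fun β hβ => ?_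
  have hdeg : β.degree = n := LemmaI.degree_eq_of_coeff_ne_zero hΦ (mem_support_iff.mp hβ)
  have h12 : β 1 + β 2 ≤ n := by
    rw [← hdeg, Finsupp.degree_eq_sum, Fin.sum_univ_three]; omega
  calc (C (ρ (coeff β Φ)) * X 0 ^ (β 1) * X 1 ^ (β 2) : MvPolynomial (Fin 2) K).totalDegree
      ≤ (C (ρ (coeff β Φ)) * X 0 ^ (β 1) : MvPolynomial (Fin 2) K).totalDegree +
          (X 1 ^ (β 2) : MvPolynomial (Fin 2) K).totalDegree := totalDegree_mul _ _
    _ ≤ ((C (ρ (coeff β Φ)) : MvPolynomial (Fin 2) K).totalDegree + (X 0 ^ (β 1) : MvPolynomial (Fin 2) K).totalDegree) +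
          (X 1 ^ (β 2) : MvPolynomial (Fin 2) K).totalDegree := by
        gcongr; exact totalDegree_mul _ _
    _ ≤ n := by rw [totalDegree_C, totalDegree_X_pow, totalDegree_X_pow]; omega

section Chart

variable {B S A : Type*} [CommRing B] [CommRing S] [CommRing A] [Algebra B S] (𝔮 : Ideal B) [𝔮.IsPrime]
  [IsLocalization.AtPrime S 𝔮] [IsLocalRing S] (Θ : B →+* A) {𝔫 : Ideal A} (h𝔫 : 𝔫.comap Θ = 𝔮)

include h𝔫 in
/-- **An `𝔪`-independent family has at most `[κ(𝔫) : κ₀]` members** (the residues of `u₁,…,u_q` are `κ₀`-linearly independent in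
`κ(S) = A/𝔫`). [folklore] -/
theorem card_le_finrank_of_indep [𝔫.IsMaximal] {K : Type*} [Field K] [Algebra K A] [Module.Finite K (A ⧸ 𝔫)]
    {R₀ : Type*} [CommRing R₀] [IsLocalRing R₀] (ι₀ : R₀ →+* B) (ρ : R₀ →+* K)
    (hρ : Function.Surjective ρ) (hρker : ∀ a, ρ a = 0 ↔ a ∈ maximalIdeal R₀)
    (hcomm : ∀ a, Θ (ι₀ a) = algebraMap K A (ρ a)) {q : ℕ} (u : Fin q → S)
    (hu : ∀ a : Fin q → R₀, (∑ i, algebraMap B S (ι₀ (a i)) * u i) ∈ maximalIdeal S → ∀ i, a i ∈ maximalIdeal R₀) :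
    q ≤ finrank K (A ⧸ 𝔫) := by
  classical
  letI := Ideal.Quotient.field 𝔫
  obtain ⟨s, hs⟩ := IsLocalization.exist_integer_multiples_of_finite 𝔮.primeCompl u
  choose r hr using hs
  -- `hr i : algebraMap B S (r i) = (s : B) • u i`
  have hrs : ∀ i, u i * algebraMap B S (s : B) = algebraMap B S (r i) := fun i => by
    rw [hr i, Algebra.smul_def, mul_comm]
  have hsn : Ideal.Quotient.mk 𝔫 (Θ s) ≠ 0 := by
    rw [Ne, Ideal.Quotient.eq_zero_iff_mem, ← Ideal.mem_comap, h𝔫]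
    exact s.2
  have hs' : algebraMap B S (s : B) ∉ maximalIdeal S := by
    rw [IsLocalization.AtPrime.to_map_mem_maximal_iff S 𝔮]
    exact s.2
  let e : Fin q → A ⧸ 𝔫 := fun i => Ideal.Quotient.mk 𝔫 (Θ (r i)) * (Ideal.Quotient.mk 𝔫 (Θ s))⁻¹
  have hli : LinearIndependent K e := by
    rw [Fintype.linearIndependent_iff]
    intro c hc i
    choose a ha using fun i => hρ (c i)
    have h1 : Ideal.Quotient.mk 𝔫 (Θ (∑ j, ι₀ (a j) * r j)) = Ideal.Quotient.mk 𝔫 (Θ s) * ∑ j, c j • e j := by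
      simp only [map_sum, map_mul, hcomm, Ideal.Quotient.mk_algebraMap, Finset.mul_sum, e, Algebra.smul_def, ha]
      refine Finset.sum_congr rfl fun j _ => ?_
      set Sv := (Ideal.Quotient.mk 𝔫) (Θ ↑s)
      set Rv := (Ideal.Quotient.mk 𝔫) (Θ (r j))
      set av := (algebraMap K (A ⧸ 𝔫)) (c j)
      calc av * Rv = av * (Sv * Sv⁻¹) * Rv := by rw [mul_inv_cancel₀ hsn, mul_one]
        _ = Sv * (av * (Rv * Sv⁻¹)) := by ring
    rw [hc, mul_zero, Ideal.Quotient.eq_zero_iff_mem, ← Ideal.mem_comap, h𝔫] at h1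
    have h3 : algebraMap B S (∑ j, ι₀ (a j) * r j) ∈ maximalIdeal S :=
      (IsLocalization.AtPrime.to_map_mem_maximal_iff S 𝔮 _).mpr h1
    have h4 : (∑ j, algebraMap B S (ι₀ (a j)) * u j) * algebraMap B S (s : B) = algebraMap B S (∑ j, ι₀ (a j) * r j) := by
      rw [map_sum, Finset.sum_mul]
      refine Finset.sum_congr rfl fun j _ => ?_
      rw [map_mul, mul_assoc, hrs j]
    rw [← h4] at h3
    have h5 : (∑ j, algebraMap B S (ι₀ (a j)) * u j) ∈ maximalIdeal S :=
      ((Ideal.IsPrime.mem_or_mem inferInstance h3).resolve_right hs')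
    rw [← ha i]
    exact (hρker _).mpr (hu a h5 i)
  simpa using hli.fintype_card_le_finrank

end Chart

/-- **Completing `(a, b)` to a regular system of parameters**: if `S/(a, b)` is regular of dimension `1` then `𝔪_S = (a, b, t)` for some `t`. [cite: Matsumura1987, Thm. 14.2] -/
theorem exists_span_triple_eq_maximalIdeal {S : Type*} [CommRing S] [IsLocalRing S] (a b : S)
    (hreg : IsRegularLocalRing (S ⧸ Ideal.span ({a, b} : Set S))) (hdim : ringKrullDim (S ⧸ Ideal.span ({a, b} : Set S)) = 1)
    (ha : a ∈ maximalIdeal S) (hb : b ∈ maximalIdeal S) :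
    ∃ t : S, Ideal.span (Set.range ![a, b, t]) = maximalIdeal S := by
  haveI := hreg
  set I : Ideal S := Ideal.span ({a, b} : Set S) with hI
  have h1 : (maximalIdeal (S ⧸ I)).spanFinrank = 1 := by
    have h := IsRegularLocalRing.spanFinrank_maximalIdeal (R := S ⧸ I)
    rw [hdim] at h
    exact_mod_cast h
  obtain ⟨hprinc, -⟩ := (Submodule.spanFinrank_eq_one_iff _).mp h1
  obtain ⟨tbar, htbar⟩ := hprinc.principal
  obtain ⟨t, rfl⟩ := Ideal.Quotient.mk_surjective tbar
  have ht : t ∈ maximalIdeal S := by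
    have h' : Ideal.Quotient.mk I t ∈ maximalIdeal (S ⧸ I) := by
      rw [htbar]; exact Submodule.mem_span_singleton_self _
    rw [mem_maximalIdeal, mem_nonunits_iff] at h' ⊢
    exact fun hu => h' (hu.map _)
  refine ⟨t, le_antisymm ?_ fun m hm => ?_⟩
  · rw [Ideal.span_le, Set.range_subset_iff]
    intro i; fin_cases i
    · exact ha
    · exact hb
    · exact ht
  · have hm' : Ideal.Quotient.mk I m ∈ maximalIdeal (S ⧸ I) := by
      rw [mem_maximalIdeal, mem_nonunits_iff] at hm ⊢
      intro hu
      obtain ⟨v, hv⟩ := Ideal.Quotient.mk_surjective (↑hu.unit⁻¹ : S ⧸ I)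
      have h2 : Ideal.Quotient.mk I (m * v) = 1 := by rw [map_mul, hv, IsUnit.mul_val_inv]
      rw [← (Ideal.Quotient.mk I).map_one, Ideal.Quotient.eq] at h2
      -- `m * v - 1 ∈ I ⊆ 𝔪`, contradiction with `m ∈ 𝔪`
      have hIle : I ≤ maximalIdeal S := by
        rw [hI, Ideal.span_le]
        rintro x (rfl | rfl)
        · exact ha
        · exact hb
      have h3 : m * v - 1 ∈ maximalIdeal S := hIle h2
      have h4 : m * v ∈ maximalIdeal S := Ideal.mul_mem_right _ _ (by rwa [mem_maximalIdeal, mem_nonunits_iff])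
      have h5 : (1 : S) ∈ maximalIdeal S := by
        have := Ideal.sub_mem _ h4 h3
        rwa [sub_sub_cancel] at this
      exact (maximalIdeal.isMaximal S).ne_top (Ideal.eq_top_of_isUnit_mem _ h5 isUnit_one)
    rw [htbar] at hm'
    obtain ⟨c, hc⟩ := Submodule.mem_span_singleton.mp hm'
    obtain ⟨c', rfl⟩ := Ideal.Quotient.mk_surjective c
    rw [smul_eq_mul, ← map_mul, Ideal.Quotient.eq, hI] at hc
    obtain ⟨α, β, hαβ⟩ := Ideal.mem_span_pair.mp hc
    have hm_eq : m = c' * t - (α * a + β * b) := by rw [hαβ]; ring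
    rw [hm_eq]
    refine Ideal.sub_mem _ (Ideal.mul_mem_left _ _ (Ideal.subset_span ⟨2, rfl⟩))
      (Ideal.add_mem _ (Ideal.mul_mem_left _ _ (Ideal.subset_span ⟨0, rfl⟩)) (Ideal.mul_mem_left _ _ (Ideal.subset_span ⟨1, rfl⟩)))

/-! ## Chart readings as explicit sums -/

/-- `eval₂ f (1, t, u) Ψ = Σ_β f(c_β)·t^{β₁}·u^{β₂}`. [folklore] -/
theorem eval₂_one_cons_eq_sum {R T : Type*} [CommSemiring R] [CommSemiring T] (f : R →+* T) (t u : T)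
    (Ψ : MvPolynomial (Fin 3) R) :
    MvPolynomial.eval₂ f ![1, t, u] Ψ = ∑ β ∈ Ψ.support, f (coeff β Ψ) * t ^ (β 1) * u ^ (β 2) := by
  rw [MvPolynomial.eval₂_eq']
  refine Finset.sum_congr rfl fun β _ => ?_
  rw [Fin.prod_univ_three]
  simp only [Matrix.cons_val_zero, Matrix.cons_val_one, Matrix.head_cons, Matrix.cons_val_two, Matrix.tail_cons, one_pow,
    one_mul, mul_assoc]

/-! ## The chart map `Θ : S₀[𝔪₀/X] → κ₀[T, U]` -/

/-- **The chart map of the `X`-chart, indexed by `Fin 2`**: for a regular system `z = (X, Y, Z)` of `S₀` there is a surjection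
`Θ : S₀[𝔪₀/X] → κ₀[T, U]` with kernel `(X)`, `Θ(s) = s̄` on `S₀`, `Θ(Y/X) = T`, `Θ(Z/X) = U` (`ClaimR.exists_chartMap` composed with the
re-indexing `{j // j ≠ 0} ≃ Fin 2`). OURS. [cite: Cutkosky2014, §2.1] [folklore] -/
theorem exists_chart_fin_two {L : Type} [Field L] (S₀ : Subring L) [IsRegularLocalRing S₀]
    (hd : (maximalIdeal S₀).spanFinrank = 3) (z : Fin 3 → S₀) (hz : Ideal.span (Set.range z) = maximalIdeal S₀) (hX0 : z 0 ≠ 0) :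
    ∃ Θ : blowupRing S₀ ((z 0 : S₀) : L) →+* MvPolynomial (Fin 2) (ResidueField S₀),
      Function.Surjective Θ ∧
      RingHom.ker Θ = Ideal.span {(⟨((z 0 : S₀) : L), le_blowupRing S₀ _ (z 0).2⟩ : blowupRing S₀ ((z 0 : S₀) : L))} ∧
      (∀ s : S₀, Θ (Subring.inclusion (le_blowupRing S₀ ((z 0 : S₀) : L)) s) = C (residue S₀ s)) ∧
      (∀ h : ((z 1 : S₀) : L) / ((z 0 : S₀) : L) ∈ blowupRing S₀ ((z 0 : S₀) : L), Θ ⟨_, h⟩ = X 0) ∧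
      (∀ h : ((z 2 : S₀) : L) / ((z 0 : S₀) : L) ∈ blowupRing S₀ ((z 0 : S₀) : L), Θ ⟨_, h⟩ = X 1) := by
  obtain ⟨Θ₀, hΘ₀s, hΘ₀k, hΘ₀C, hΘ₀X⟩ := ClaimR.exists_chartMap S₀ hd z hz 0 hX0
  let eσ : {j : Fin 3 // j ≠ 0} ≃ Fin 2 := (finSuccAboveEquiv (0 : Fin 3)).symm
  let ρ₂ : MvPolynomial {j : Fin 3 // j ≠ 0} (ResidueField S₀) ≃ₐ[ResidueField S₀] MvPolynomial (Fin 2) (ResidueField S₀) :=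
    renameEquiv _ eσ
  have heσ1 : eσ ⟨1, by decide⟩ = 0 := by
    rw [Equiv.symm_apply_eq, finSuccAboveEquiv_apply]; exact Subtype.ext (by simp)
  have heσ2 : eσ ⟨2, by decide⟩ = 1 := by
    rw [Equiv.symm_apply_eq, finSuccAboveEquiv_apply]; exact Subtype.ext (by simp [Fin.succAbove])
  refine ⟨ρ₂.toRingEquiv.toRingHom.comp Θ₀, ρ₂.surjective.comp hΘ₀s, ?_, fun s => ?_, fun h => ?_, fun h => ?_⟩
  · rw [← hΘ₀k]
    exact RingHom.ker_equiv_comp Θ₀ ρ₂.toRingEquiv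
  · change rename eσ (Θ₀ _) = _
    rw [hΘ₀C, rename_C]
  · change rename eσ (Θ₀ _) = _
    rw [hΘ₀X ⟨1, by decide⟩ h, rename_X, heσ1]
  · change rename eσ (Θ₀ _) = _
    rw [hΘ₀X ⟨2, by decide⟩ h, rename_X, heσ2]

/-! ## `x₀S₁ = XS₁` bookkeeping -/

/-- Two generators of the same principal ideal of a domain differ by inverse units. [folklore] -/
theorem exists_mul_eq_of_span_singleton_eq {S : Type*} [CommRing S] [IsDomain S] {x₀ X' : S}
    (hspan : Ideal.span ({x₀} : Set S) = Ideal.span {X'}) (hX'0 : X' ≠ 0) :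
    ∃ v v' : S, v * x₀ = X' ∧ v' * X' = x₀ ∧ v * v' = 1 := by
  obtain ⟨v, hv⟩ := Ideal.mem_span_singleton'.mp (hspan ▸ Ideal.mem_span_singleton_self X' :
    X' ∈ Ideal.span ({x₀} : Set S))
  obtain ⟨v', hv'⟩ := Ideal.mem_span_singleton'.mp (hspan.symm ▸ Ideal.mem_span_singleton_self x₀ :
    x₀ ∈ Ideal.span ({X'} : Set S))
  refine ⟨v, v', hv, hv', ?_⟩
  have h : (v * v') * X' = 1 * X' := by rw [mul_assoc, hv', hv, one_mul]
  exact mul_right_cancel₀ hX'0 h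

/-- If `(x₀) = (X')`, `dim S/(x₀, w) = 1` and `dim S/(X') + 1 = 3`, then `w ∉ (X')` (else `(x₀, w) = (X')` and `1 + 1 = 3`). [folklore] -/
theorem not_mem_span_singleton_of_ringKrullDim {S : Type*} [CommRing S] {x₀ w X' : S}
    (hspan : Ideal.span ({x₀} : Set S) = Ideal.span {X'})
    (hWdim : ringKrullDim (S ⧸ Ideal.span ({x₀, w} : Set S)) = 1)
    (hdimX : ringKrullDim (S ⧸ Ideal.span ({X'} : Set S)) + 1 = 3) : w ∉ Ideal.span ({X'} : Set S) := by
  intro h2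
  have hX'P : X' ∈ Ideal.span ({x₀, w} : Set S) :=
    Ideal.span_mono (Set.singleton_subset_iff.mpr (Set.mem_insert _ _))
      (hspan ▸ Ideal.mem_span_singleton_self X' : X' ∈ Ideal.span ({x₀} : Set S))
  have h3 : Ideal.span ({x₀, w} : Set S) = Ideal.span {X'} := by
    refine le_antisymm ?_ ((Ideal.span_singleton_le_iff_mem _).mpr hX'P)
    rw [Ideal.span_le]
    rintro y (rfl | rfl)
    · exact hspan ▸ Ideal.mem_span_singleton_self y
    · exact h2
  have h4 : ringKrullDim (S ⧸ Ideal.span ({X'} : Set S)) = 1 := by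
    rw [← ringKrullDim_eq_of_ringEquiv (Ideal.quotEquivOfEq h3)]; exact hWdim
  rw [h4] at hdimX
  have h5 : ((1 + 1 : ℕ) : WithBot ℕ∞) = ((3 : ℕ) : WithBot ℕ∞) := by push_cast; exact hdimX
  exact absurd (Nat.cast_injective h5) (by norm_num)

/-! ## The cleaning read in the chart ring -/

/-- **Clean reading in `B`.** If `S = B_𝔮` (local), `f₁ = F_b·v^d` with `v` a unit and `d = 2m`, and `f₁ − g₁² ∈ 𝔪_S^d`, then
`s²F_b = b² + b′` for some `s ∉ 𝔮`, `b ∈ B`, `b′ ∈ 𝔮^d` (clear the denominators of `v^m` and `g₁`). [cite: Matsumura1987, Thm. 4.1] [folklore] -/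
theorem exists_clean_reading {B S : Type*} [CommRing B] [CommRing S] [IsLocalRing S] [Algebra B S]
    (𝔮 : Ideal B) [𝔮.IsPrime] [IsLocalization.AtPrime S 𝔮]
    (hmem𝔮 : ∀ c : B, c ∈ 𝔮 ↔ algebraMap B S c ∈ maximalIdeal S) (hinj : Function.Injective (algebraMap B S))
    {Fb : B} {f₁ v g₁ : S} {d m : ℕ} (hm : d = m + m) (hvu : IsUnit v)
    (hf₁ : f₁ = algebraMap B S Fb * v ^ d) (hg₁ : f₁ - g₁ ^ 2 ∈ maximalIdeal S ^ d) :
    ∃ s b b' : B, s ∉ 𝔮 ∧ s ^ 2 * Fb = b ^ 2 + b' ∧ b' ∈ 𝔮 ^ d := by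
  obtain ⟨⟨r₁, s₁⟩, hr₁⟩ := IsLocalization.surj 𝔮.primeCompl (v ^ m : S)
  obtain ⟨⟨r₂, s₂⟩, hr₂⟩ := IsLocalization.surj 𝔮.primeCompl (g₁ : S)
  simp only at hr₁ hr₂
  -- `hr₁ : v ^ m * algebraMap s₁ = algebraMap r₁`, `hr₂ : g₁ * algebraMap s₂ = algebraMap r₂`
  set y : B := r₁ ^ 2 * (s₂ : B) ^ 2 * Fb - (s₁ : B) ^ 2 * r₂ ^ 2 with hy
  have hyS : algebraMap B S y = algebraMap B S ((s₁ : B) * s₂) ^ 2 * (f₁ - g₁ ^ 2) := by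
    simp only [hy, map_sub, map_mul, map_pow]
    rw [hf₁, hm, pow_add]
    linear_combination (-(algebraMap B S (s₂ : B) ^ 2 * algebraMap B S Fb *
        (algebraMap B S r₁ + v ^ m * algebraMap B S (s₁ : B)))) * hr₁ +
      (algebraMap B S (s₁ : B) ^ 2 * (algebraMap B S r₂ + g₁ * algebraMap B S (s₂ : B))) * hr₂
  have hymem : algebraMap B S y ∈ Ideal.map (algebraMap B S) (𝔮 ^ d) := by
    rw [Ideal.map_pow, IsLocalization.AtPrime.map_eq_maximalIdeal 𝔮 S, hyS]
    exact Ideal.mul_mem_left _ _ hg₁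
  obtain ⟨⟨i, s₃⟩, his⟩ := (IsLocalization.mem_map_algebraMap_iff 𝔮.primeCompl S).mp hymem
  simp only at his
  -- `his : algebraMap y * algebraMap s₃ = algebraMap i`, `i ∈ 𝔮 ^ d`
  have hys₃ : y * s₃ = i := hinj (by rw [map_mul]; exact his)
  refine ⟨r₁ * s₂ * s₃, s₁ * r₂ * s₃, s₃ * (y * s₃), fun h => ?_, ?_, ?_⟩
  · rcases Ideal.IsPrime.mem_or_mem inferInstance h with h | h
    · rcases Ideal.IsPrime.mem_or_mem inferInstance h with h | h
      · have h1 : v ^ m * algebraMap B S (s₁ : B) ∈ maximalIdeal S := by rw [hr₁]; exact (hmem𝔮 r₁).mp h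
        rcases Ideal.IsPrime.mem_or_mem inferInstance h1 with h2 | h2
        · exact (mem_maximalIdeal _).mp (Ideal.IsPrime.mem_of_pow_mem inferInstance m h2) hvu
        · exact s₁.2 ((hmem𝔮 _).mpr h2)
      · exact s₂.2 h
    · exact s₃.2 h
  · simp only [hy]; ring
  · rw [hys₃]; exact Ideal.mul_mem_left _ _ i.2

/-! ## The closing move: all derivations ⇒ formal square root ⇒ non-isolated -/

/-- **Non-isolatedness from the all-derivations test.** `S₁` regular local of dimension `3`, excellent, inside a field of
characteristic `2`; `x₀, w ∈ 𝔪₁`; a Cohen frame `Ŝ₁ ≃ K′⟦X₀, X₁, X₂⟧` with `x̂₀ ↦ X₀`, `ŵ ↦ X₁`; `f̂₁ = F·ĉ^d` with `d` even. If every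
`ℤ`-derivation of `K′⟦X⟧` takes `F` into `(X₀, X₁)`, then `F·ĉ^d` has the same property (`d` is even), the formal square criterion
(FILE C) gives `f̂₁ − B̂² ∈ (x̂₀, ŵ)²Ŝ₁`, the persistent-arc criterion (`#{x̂₀, ŵ} = 2 < 3 = dim Ŝ₁`) makes `Ŝ₁[√f̂₁]` non-isolated, and
excellence descends this to `S₁[√f₁]`. OURS. [cite: Matsumura1987, Thm. 28.3, Thm. 30.6] [folklore] -/
theorem not_hasIsolatedSingularity_of_forall_derivation {L : Type} [Field L] [CharP L 2]
    (S₁ : Subring L) [IsLocalRing S₁] (hreg₁ : IsRegularLocalRing S₁) (hexc : IsExcellentRing S₁)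
    (hdim₁ : ringKrullDim S₁ = 3) {x₀ w : S₁} (hx₀m : x₀ ∈ maximalIdeal S₁) (hwm : w ∈ maximalIdeal S₁)
    (frame : AdicCompletion (maximalIdeal S₁) S₁ ≃+*
      MvPowerSeries (Fin 3) (ResidueField (AdicCompletion (maximalIdeal S₁) S₁)))
    (hfx₀ : frame (algebraMap S₁ _ x₀) = MvPowerSeries.X 0) (hfw : frame (algebraMap S₁ _ w) = MvPowerSeries.X 1)
    (f₁ c : S₁) (F : MvPowerSeries (Fin 3) (ResidueField (AdicCompletion (maximalIdeal S₁) S₁))) {d : ℕ} (hd : Even d)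
    (hF : frame (algebraMap S₁ _ f₁) = F * frame (algebraMap S₁ _ c) ^ d)
    (hall : ∀ Δ : Derivation ℤ (MvPowerSeries (Fin 3) (ResidueField (AdicCompletion (maximalIdeal S₁) S₁)))
        (MvPowerSeries (Fin 3) (ResidueField (AdicCompletion (maximalIdeal S₁) S₁))),
      Δ F ∈ Ideal.span ({MvPowerSeries.X 0, MvPowerSeries.X 1} :
        Set (MvPowerSeries (Fin 3) (ResidueField (AdicCompletion (maximalIdeal S₁) S₁))))) :
    ¬ HasIsolatedSingularity (RadicandRing S₁ 2 f₁) := by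
  classical
  haveI := hreg₁
  haveI : Fact (Nat.Prime 2) := ⟨Nat.prime_two⟩
  set Sh := AdicCompletion (maximalIdeal S₁) S₁ with hShdef
  set K' := ResidueField (AdicCompletion (maximalIdeal S₁) S₁) with hK'def
  set A := MvPowerSeries (Fin 3) K' with hAdef
  set ι₁ : S₁ →+* Sh := algebraMap S₁ Sh with hι₁def
  haveI hSh2 : CharP Sh 2 := RadicandCohenFrame.charP_adicCompletion 2 S₁
  haveI hShreg : IsRegularLocalRing Sh := isRegularLocalRing_adicCompletion S₁
  haveI hA2 : CharP A 2 := charP_of_injective_ringHom (f := frame.toRingHom) frame.injective 2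
  haveI hK'2 : CharP K' 2 := by
    refine (CharP.charP_iff_prime_eq_zero Nat.prime_two).mpr ?_
    rw [← map_natCast (residue Sh) 2, CharP.cast_eq_zero, map_zero]
  obtain ⟨m, hm⟩ := hd
  have hdA : ((d : ℕ) : A) = 0 := by
    rw [hm, ← two_mul, Nat.cast_mul, show ((2 : ℕ) : A) = 0 from CharP.cast_eq_zero A 2, zero_mul]
  have hallF : ∀ Δ : Derivation ℤ A A, Δ (frame (ι₁ f₁)) ∈ Ideal.span ({MvPowerSeries.X 0, MvPowerSeries.X 1} : Set A) := by
    intro Δ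
    rw [hF, Derivation.leibniz, Derivation.leibniz_pow]
    simp only [smul_eq_mul, nsmul_eq_mul, hdA, zero_mul, mul_zero, zero_add]
    exact Ideal.mul_mem_left _ _ (hall Δ)
  obtain ⟨BA, hBA⟩ := exists_sub_sq_mem_sq_of_forall_derivation (frame (ι₁ f₁)) hallF
  have hι𝔪 : ∀ a ∈ maximalIdeal S₁, ι₁ a ∈ maximalIdeal Sh := fun a ha => by
    have h := (CompletionTransfer.mem_maximalIdeal_pow_iff_adicCompletion a 1).mp (by rw [pow_one]; exact ha)
    rwa [pow_one] at h
  have hTf : ι₁ f₁ - frame.symm BA ^ 2 ∈ Ideal.span ({ι₁ x₀, ι₁ w} : Set Sh) ^ 2 := by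
    have h1 := Ideal.mem_map_of_mem frame.symm.toRingHom hBA
    rw [Ideal.map_pow, Ideal.map_span, Set.image_pair, map_sub, map_pow] at h1
    have e0 : frame.symm.toRingHom (MvPowerSeries.X 0) = ι₁ x₀ := by
      rw [← hfx₀]; exact frame.symm_apply_apply _
    have e1 : frame.symm.toRingHom (MvPowerSeries.X 1) = ι₁ w := by
      rw [← hfw]; exact frame.symm_apply_apply _
    have e2 : frame.symm.toRingHom (frame (ι₁ f₁)) = ι₁ f₁ := frame.symm_apply_apply _
    rw [e0, e1, e2] at h1
    exact h1
  have hdimSh : ringKrullDim Sh = 3 := (ringKrullDim_adicCompletion S₁).trans hdim₁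
  have hSh : ¬ HasIsolatedSingularity (RadicandRing Sh 2 (ι₁ f₁)) := by
    refine PersistentArc.not_hasIsolatedSingularity_of_sub_pow_mem_sq_span' 2 (ι₁ f₁) (frame.symm BA) {ι₁ x₀, ι₁ w}
      (fun t' ht' => ?_) (by simpa using hTf) (lt_of_le_of_lt Finset.card_le_two (by norm_num)) hdimSh
    simp only [Finset.mem_insert, Finset.mem_singleton] at ht'
    rcases ht' with rfl | rfl
    · exact hι𝔪 x₀ hx₀m
    · exact hι𝔪 w hwm
  exact NoSatelliteStep.not_hasIsolatedSingularity_of_adicCompletion 2 hexc f₁ hSh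

end Summit.ResolutionOfSingularities.ResolutionOfSingularities.Theorems.SwitchingDichotomy.LemmaI2

end
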